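import Summits.Ventures.PercRepro.RankLevelSetRuleQCornerReduction
import Summits.Ventures.PercRepro.RankLevelSetRuleQCornerLargeQ

/-!
# PercRepro — THE CORNER THROUGH THE DIAGONAL CHAIN OF THE MASTER SUM: `R̂ − Φ = 1 + S(q+k,q) − S(q,q+1−k) − tail`
(p4, gen 29; C-044; paper proofs/P4-CELL-THREE.md §13.12)

At the corner `m = q + 1 − k` (`n = q + k − m = 2k − 1`) the binomial expansion of the tilt,
`Σ_{i ≤ 2k−1} C(2k−1,i)·W_i(q,m) = S(q, q+k)` (`sum_choose_sumW`, from `sumW_succ`), and the identity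
`Φ(q+k,q) = S(q,q+k) − 1 − S(q+k,q)` (`phiK_eq_sumS`: termwise `C(q+k,k+z)/C(q+k+z,k+z) = C(q,z)/C(q+k+z,z)`)
give the **exact corner identity** `rhat_sub_phiK_corner`:
`R̂(q,k,m) − Φ(q+k,q) = 1 + S(q+k,q) − S(q,m) − tail`, `tail = Σ_{k ≤ i < 2k} C(2k−1,i)·W_i(q,m) ≥ 0`.
The two master sums are compared along the diagonal: `S(Q+1,M+1) = (Q+1)/Q·(S(Q,M) − W_2(Q,M))` (`sumW_qsucc` and
`sumW_succ`) with `(Q+M+2)·W_2 = S − (Q−M−1)·W_1 ≤ S` (`sumW_rec` at `j = 0`) gives `S(Q,M) ≤ S(Q+1,M+1)` (`sumS_diag_mono`),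
hence `S(q,m) ≤ S(q+k−1,q)`; the last `q`-step `S(q+k,q) = (q+k)/(q+k−1)·(S(q+k−1,q) − W_1(q+k−1,q))` with the anchor
`(2q+k)·W_1(q+k−1,q) ≤ q+k−1` (`sumW_one_anchor`) leaves `1 + S(q+k,q) − S(q,m) ≥ q/(2q+k)`.  Therefore
**`rhat_corner_of_tail`: `tail ≤ q/(2q+k)` implies the corner `Φ(q+k,q) ≤ R̂(q,k,q+1−k)`** — and with
RankLevelSetRuleQCornerReduction the whole untruncated regime.  The tail is bounded in RankLevelSetRuleQCornerTail
(`tail ≤ 4^{k−1}·W_k`, `tail_le_pow_mul_sumW`, and the two-step bound `(2q+1+j)·W_{j+2} ≤ (j+1)·W_j`, `sumW_two_step`).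
Axioms standard.
-/

namespace PercRepro

open Finset

/-- `W` is antitone in its index: `W_{i+1}(q,m) ≤ W_i(q,m)` (termwise `C(q+n, n) ≤ C(q+n+1, n+1)`). -/
lemma sumW_succ_le (q m i : ℕ) : sumW q m (i + 1) ≤ sumW q m i := by
  unfold sumW
  apply Finset.sum_le_sum
  intro a _
  have h1 : ((q + (i + a)).choose (i + a) : ℚ) ≤ ((q + (i + 1 + a)).choose (i + 1 + a) : ℚ) := by
    have : (q + (i + a)).choose (i + a) ≤ (q + (i + a) + 1).choose (i + a + 1) := by
      rw [Nat.choose_succ_succ]; exact Nat.le_add_right _ _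
    rw [show q + (i + 1 + a) = q + (i + a) + 1 by omega, show i + 1 + a = i + a + 1 by omega]
    exact_mod_cast this
  have h0 : (0 : ℚ) < ((q + (i + a)).choose (i + a) : ℚ) := by
    exact_mod_cast Nat.choose_pos (by omega)
  exact div_le_div_of_nonneg_left (by positivity) h0 h1

/-- `W_j(q,m) ≤ W_i(q,m)` for `i ≤ j`. -/
lemma sumW_anti (q m : ℕ) : Antitone (sumW q m) :=
  antitone_nat_of_succ_le (sumW_succ_le q m)

/-- **The two-step bound**: for `m + 1 ≤ q` and every `j`, `(2q+1+j)·W_{j+2} ≤ (j+1)·W_j` (the recurrence `sumW_rec` with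
`W_{j+2} ≤ W_{j+1}`). -/
lemma sumW_two_step (q m j : ℕ) (hm : m + 1 ≤ q) :
    (2 * (q : ℚ) + 1 + j) * sumW q m (j + 2) ≤ ((j : ℚ) + 1) * sumW q m j := by
  have hrec := sumW_rec q m j
  have hmono : sumW q m (j + 2) ≤ sumW q m (j + 1) := sumW_succ_le q m (j + 1)
  have hq : (0 : ℚ) ≤ (q : ℚ) - m - 1 := by
    have : (m : ℚ) + 1 ≤ q := by exact_mod_cast hm
    linarith
  have hprod := mul_le_mul_of_nonneg_left hmono hq
  linarith

/-- Iterating the two-step bound from `W_0 = S`: for `m + 1 ≤ q`,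
`Π_{i<h}(2q+2i+1) · W_{2h}(q,m) ≤ Π_{i<h}(2i+1) · S(q,m)`. -/
lemma sumW_even_le (q m : ℕ) (hm : m + 1 ≤ q) (h : ℕ) :
    (∏ i ∈ range h, (2 * (q : ℚ) + 2 * i + 1)) * sumW q m (2 * h)
      ≤ (∏ i ∈ range h, (2 * (i : ℚ) + 1)) * sumS q m := by
  induction h with
  | zero => simp [sumW_zero]
  | succ h ih =>
    rw [Finset.prod_range_succ, Finset.prod_range_succ]
    have hstep := sumW_two_step q m (2 * h) hm
    have hP : 0 ≤ ∏ i ∈ range h, (2 * (q : ℚ) + 2 * i + 1) :=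
      Finset.prod_nonneg (fun i _ => by positivity)
    have hP' : 0 ≤ ∏ i ∈ range h, (2 * (i : ℚ) + 1) :=
      Finset.prod_nonneg (fun i _ => by positivity)
    push_cast at hstep
    rw [show 2 * (h + 1) = 2 * h + 2 by ring]
    calc (∏ i ∈ range h, (2 * (q : ℚ) + 2 * i + 1)) * (2 * (q : ℚ) + 2 * h + 1) * sumW q m (2 * h + 2)
        = (∏ i ∈ range h, (2 * (q : ℚ) + 2 * i + 1)) * ((2 * (q : ℚ) + 1 + 2 * h) * sumW q m (2 * h + 2)) := by
          ring
      _ ≤ (∏ i ∈ range h, (2 * (q : ℚ) + 2 * i + 1)) * ((2 * (h : ℚ) + 1) * sumW q m (2 * h)) :=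
          mul_le_mul_of_nonneg_left hstep hP
      _ = (2 * (h : ℚ) + 1) * ((∏ i ∈ range h, (2 * (q : ℚ) + 2 * i + 1)) * sumW q m (2 * h)) := by ring
      _ ≤ (2 * (h : ℚ) + 1) * ((∏ i ∈ range h, (2 * (i : ℚ) + 1)) * sumS q m) :=
          mul_le_mul_of_nonneg_left ih (by positivity)
      _ = (∏ i ∈ range h, (2 * (i : ℚ) + 1)) * (2 * (h : ℚ) + 1) * sumS q m := by ring

/-- `Σ_{k ≤ i < 2k} C(2k−1, i) = 4^{k−1}` for `1 ≤ k` (the upper half of the row `2k−1`). -/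
lemma sum_Ico_choose_upper (k : ℕ) (hk : 1 ≤ k) :
    ∑ i ∈ Ico k (2 * k), (2 * k - 1).choose i = 4 ^ (k - 1) := by
  obtain ⟨l, rfl⟩ : ∃ l, k = l + 1 := ⟨k - 1, by omega⟩
  have htot := Nat.sum_range_choose (2 * l + 1)
  have hhalf := Nat.sum_range_choose_halfway l
  have hsplit := Finset.sum_range_add_sum_Ico (fun i => (2 * l + 1).choose i) (show l + 1 ≤ 2 * l + 1 + 1 by omega)
  rw [show 2 * (l + 1) - 1 = 2 * l + 1 by omega, show 2 * (l + 1) = 2 * l + 1 + 1 by omega,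
    show l + 1 - 1 = l by omega]
  have h4 : 2 ^ (2 * l + 1) = 4 ^ l + 4 ^ l := by
    rw [pow_succ, pow_mul]; norm_num; ring
  omega

/-- **`tail ≤ 4^{k−1}·W_k`**: every `W_i` with `i ≥ k` is at most `W_k`. -/
lemma tail_le_pow_mul_sumW (q m k : ℕ) (hk : 1 ≤ k) :
    ∑ i ∈ Ico k (2 * k), ((2 * k - 1).choose i : ℚ) * sumW q m i ≤ (4 : ℚ) ^ (k - 1) * sumW q m k := by
  calc ∑ i ∈ Ico k (2 * k), ((2 * k - 1).choose i : ℚ) * sumW q m i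
      ≤ ∑ i ∈ Ico k (2 * k), ((2 * k - 1).choose i : ℚ) * sumW q m k := by
        apply Finset.sum_le_sum
        intro i hi
        rw [Finset.mem_Ico] at hi
        exact mul_le_mul_of_nonneg_left (sumW_anti q m hi.1) (by positivity)
    _ = (∑ i ∈ Ico k (2 * k), ((2 * k - 1).choose i : ℚ)) * sumW q m k := by rw [Finset.sum_mul]
    _ = (4 : ℚ) ^ (k - 1) * sumW q m k := by
        congr 1
        exact_mod_cast sum_Ico_choose_upper k hk

/-- **The binomial expansion of the tilt**: `Σ_{i ≤ n} C(n,i)·W_i(q,m) = S(q, m+n)` (Pascal, from `sumW_succ`). -/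
lemma sum_choose_sumW (q : ℕ) : ∀ n m : ℕ,
    ∑ i ∈ range (n + 1), (n.choose i : ℚ) * sumW q m i = sumS q (m + n) := by
  intro n
  induction n with
  | zero => intro m; simp [sumW_zero]
  | succ n ih =>
    intro m
    have hW : ∀ i, sumW q (m + 1) i = sumW q m i + sumW q m (i + 1) := fun i => by
      have := sumW_succ q m i; linarith
    have h1 := ih (m + 1)
    rw [show m + 1 + n = m + (n + 1) by omega] at h1
    rw [← h1]
    simp_rw [hW, mul_add, Finset.sum_add_distrib]
    -- peel `i = 0` on the left
    rw [Finset.sum_range_succ' (fun i => ((n + 1).choose i : ℚ) * sumW q m i) (n + 1)]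
    have hpascal : ∑ i ∈ range (n + 1), ((n + 1).choose (i + 1) : ℚ) * sumW q m (i + 1)
        = ∑ i ∈ range (n + 1), (n.choose i : ℚ) * sumW q m (i + 1)
          + ∑ i ∈ range (n + 1), (n.choose (i + 1) : ℚ) * sumW q m (i + 1) := by
      rw [← Finset.sum_add_distrib]
      refine Finset.sum_congr rfl (fun i _ => ?_)
      rw [Nat.choose_succ_succ']
      push_cast
      ring
    have hshift : ∑ i ∈ range (n + 1), (n.choose (i + 1) : ℚ) * sumW q m (i + 1)
          + ((n + 1).choose 0 : ℚ) * sumW q m 0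
        = ∑ i ∈ range (n + 1), (n.choose i : ℚ) * sumW q m i := by
      rw [Finset.sum_range_succ' (fun i => (n.choose i : ℚ) * sumW q m i) n,
        Finset.sum_range_succ (fun i => (n.choose (i + 1) : ℚ) * sumW q m (i + 1)) n,
        Nat.choose_succ_self]
      simp
    rw [hpascal]
    linarith

/-- The reindexed tail of the row `q+k`: `Σ_{z ≤ q} C(q+k, k+z)/C(q+k+z, k+z) = S(q+k, q)`
(termwise `C(q+k,k+z)·C(q+k+z,z) = C(q,z)·C(q+k+z,k+z)`). -/
lemma sum_choose_tail_eq_sumS (q k : ℕ) :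
    ∑ z ∈ range (q + 1), ((q + k).choose (k + z) : ℚ) / ((q + (k + z)).choose (k + z) : ℚ) = sumS (q + k) q := by
  unfold sumS
  refine Finset.sum_congr rfl (fun z hz => ?_)
  rw [Finset.mem_range] at hz
  have hz' : z ≤ q := by omega
  rw [Nat.cast_choose ℚ (show k + z ≤ q + k by omega), Nat.cast_choose ℚ (show k + z ≤ q + (k + z) by omega),
    Nat.cast_choose ℚ hz', Nat.cast_choose ℚ (show z ≤ q + k + z by omega)]
  rw [show q + k - (k + z) = q - z by omega, show q + (k + z) - (k + z) = q by omega,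
    show q + k + z - z = q + k by omega]
  have h1 : (0 : ℚ) < (q + k).factorial := by positivity
  have h2 : (0 : ℚ) < (k + z).factorial := by positivity
  have h3 : (0 : ℚ) < (q - z).factorial := by positivity
  have h4 : (0 : ℚ) < (q + (k + z)).factorial := by positivity
  have h5 : (0 : ℚ) < q.factorial := by positivity
  have h6 : (0 : ℚ) < z.factorial := by positivity
  rw [show q + k + z = q + (k + z) by omega]
  field_simp

/-- **`Φ` through the master sums**: `Φ(q+k, q) = S(q, q+k) − 1 − S(q+k, q)` for `1 ≤ k`. -/
lemma phiK_eq_sumS (q k : ℕ) (hk : 1 ≤ k) :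
    phiK (q + k) q = sumS q (q + k) - 1 - sumS (q + k) q := by
  rw [phiK_eq_sum_Ioo q k hk]
  have hfull : sumS q (q + k) = ∑ y ∈ range (q + k + 1), ((q + k).choose y : ℚ) / ((q + y).choose y : ℚ) := rfl
  have hsplit := Finset.sum_range_add_sum_Ico (fun y => ((q + k).choose y : ℚ) / ((q + y).choose y : ℚ))
    (show k ≤ q + k + 1 by omega)
  have htail : ∑ y ∈ Ico k (q + k + 1), ((q + k).choose y : ℚ) / ((q + y).choose y : ℚ) = sumS (q + k) q := by
    rw [Finset.sum_Ico_eq_sum_range, show q + k + 1 - k = q + 1 by omega]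
    exact sum_choose_tail_eq_sumS q k
  have hhead : ∑ y ∈ range k, ((q + k).choose y : ℚ) / ((q + y).choose y : ℚ)
      = 1 + ∑ J ∈ Ioo 0 k, ((q + k).choose J : ℚ) * (1 / ((q + J).choose J : ℚ)) := by
    obtain ⟨l, rfl⟩ : ∃ l, k = l + 1 := ⟨k - 1, by omega⟩
    rw [Finset.sum_range_succ', sumIooZeroRat, show l + 1 - 1 = l by omega]
    simp only [Nat.choose_zero_right, Nat.add_zero, Nat.cast_one, div_one]
    rw [add_comm]
    congr 1
    refine Finset.sum_congr rfl (fun j _ => ?_)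
    ring
  rw [hfull, ← hsplit, htail, hhead]
  ring

/-- **The corner identity** (`1 ≤ k ≤ q + 1`, `m = q + 1 − k`):
`R̂(q,k,m) − Φ(q+k,q) = 1 + S(q+k,q) − S(q,m) − Σ_{k ≤ i < 2k} C(2k−1,i)·W_i(q,m)`. -/
theorem rhat_sub_phiK_corner (q k : ℕ) (hk : 1 ≤ k) (hkq : k ≤ q + 1) :
    rhat q k (q + 1 - k) - phiK (q + k) q
      = 1 + sumS (q + k) q - sumS q (q + 1 - k)
        - ∑ i ∈ Ico k (2 * k), ((2 * k - 1).choose i : ℚ) * sumW q (q + 1 - k) i := by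
  set m := q + 1 - k with hm
  have hR : rhat q k m = ∑ i ∈ Ioo 0 k, ((2 * k - 1).choose i : ℚ) * sumW q m i := by
    rw [rhat_eq_sumW q k m (by omega), show q + k - m = 2 * k - 1 by omega]
  have hexp := sum_choose_sumW q (2 * k - 1) m
  rw [show m + (2 * k - 1) = q + k by omega, show 2 * k - 1 + 1 = 2 * k by omega] at hexp
  have hsplit := Finset.sum_range_add_sum_Ico (fun i => ((2 * k - 1).choose i : ℚ) * sumW q m i)
    (show k ≤ 2 * k by omega)
  have hhead : ∑ i ∈ range k, ((2 * k - 1).choose i : ℚ) * sumW q m i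
      = sumS q m + ∑ i ∈ Ioo 0 k, ((2 * k - 1).choose i : ℚ) * sumW q m i := by
    obtain ⟨l, hl⟩ : ∃ l, k = l + 1 := ⟨k - 1, by omega⟩
    rw [hl, Finset.sum_range_succ', sumIooZeroRat, show l + 1 - 1 = l by omega]
    simp only [Nat.choose_zero_right, Nat.cast_one, one_mul, sumW_zero]
    ring
  have hphi := phiK_eq_sumS q k hk
  rw [hR, hphi]
  linarith

/-- **`S` is non-decreasing along diagonals**: `S(Q,M) ≤ S(Q+1,M+1)` for `M + 1 ≤ Q`
(`S(Q+1,M+1) = (Q+1)/Q·(S(Q,M) − W_2(Q,M))` and `(Q+1)·W_2 ≤ (Q+M+2)·W_2 ≤ S`). -/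
lemma sumS_diag_mono (Q M : ℕ) (hM : M + 1 ≤ Q) : sumS Q M ≤ sumS (Q + 1) (M + 1) := by
  have hQ : 0 < Q := by omega
  have hQ' : (0 : ℚ) < Q := by exact_mod_cast hQ
  have hsh := sumW_qsucc Q (M + 1) 0 hQ
  rw [sumW_zero, sumW_zero] at hsh
  have h1 : sumS Q (M + 1) = sumS Q M + sumW Q M 1 := by
    have := sumW_succ Q M 0; rw [sumW_zero, sumW_zero] at this; linarith
  have h2 : sumW Q (M + 1) 1 = sumW Q M 1 + sumW Q M 2 := by
    have := sumW_succ Q M 1; linarith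
  have hrec := sumW_rec Q M 0
  norm_num at hrec
  rw [sumW_zero] at hrec
  have hW1 := sumW_pos Q M 1
  have hW2 := sumW_pos Q M 2
  have hQM : (0 : ℚ) ≤ (Q : ℚ) - M - 1 := by
    have : (M : ℚ) + 1 ≤ Q := by exact_mod_cast hM
    linarith
  have hM0 : (0 : ℚ) ≤ (M : ℚ) + 1 := by positivity
  have key : ((Q : ℚ) + 1) * sumW Q M 2 ≤ sumS Q M := by
    have p1 := mul_nonneg hQM hW1.le
    have p2 := mul_nonneg hM0 hW2.le
    linarith
  have hdiff : sumS (Q + 1) (M + 1) - sumS Q M = (sumS Q M - ((Q : ℚ) + 1) * sumW Q M 2) / Q := by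
    rw [hsh, h1, h2]
    field_simp
    ring
  have : 0 ≤ sumS (Q + 1) (M + 1) - sumS Q M := by
    rw [hdiff]; exact div_nonneg (by linarith) hQ'.le
  linarith

/-- The diagonal chain from the corner: `S(q, q+1−k) ≤ S(q+j, q+1−k+j)` for every `j` (`2 ≤ k ≤ q + 1`). -/
lemma sumS_diag_chain (q k : ℕ) (hk : 2 ≤ k) (hkq : k ≤ q + 1) :
    ∀ j, sumS q (q + 1 - k) ≤ sumS (q + j) (q + 1 - k + j) := by
  intro j
  induction j with
  | zero => simp
  | succ j ih =>
    have hstep := sumS_diag_mono (q + j) (q + 1 - k + j) (by omega)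
    rw [show q + (j + 1) = q + j + 1 by omega, show q + 1 - k + (j + 1) = q + 1 - k + j + 1 by omega]
    exact ih.trans hstep

/-- **The corner from the tail**: for `2 ≤ k ≤ q + 1`, if `Σ_{k ≤ i < 2k} C(2k−1,i)·W_i(q,q+1−k) ≤ q/(2q+k)` then
`Φ(q+k,q) ≤ R̂(q,k,q+1−k)`. -/
theorem rhat_corner_of_tail (q k : ℕ) (hk : 2 ≤ k) (hkq : k ≤ q + 1)
    (htail : ∑ i ∈ Ico k (2 * k), ((2 * k - 1).choose i : ℚ) * sumW q (q + 1 - k) i ≤ (q : ℚ) / (2 * q + k)) :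
    phiK (q + k) q ≤ rhat q k (q + 1 - k) := by
  have hid := rhat_sub_phiK_corner q k (by omega) hkq
  have hchain := sumS_diag_chain q k hk hkq (k - 1)
  rw [show q + 1 - k + (k - 1) = q by omega, show q + (k - 1) = q + k - 1 by omega] at hchain
  have hq0 : 0 < q + k - 1 := by omega
  have hsh := sumW_qsucc (q + k - 1) q 0 hq0
  rw [sumW_zero, sumW_zero, show q + k - 1 + 1 = q + k by omega] at hsh
  have hanc := sumW_one_anchor (q + k - 1) q
  have hcast : ((q + k - 1 : ℕ) : ℚ) = (q : ℚ) + k - 1 := by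
    rw [Nat.cast_sub (by omega)]; push_cast; ring
  rw [hcast] at hsh hanc
  norm_num at hsh
  have hW1 := sumW_pos (q + k - 1) q 1
  have hS1 := sumS_pos (q + k - 1) q
  have hS0 := sumS_pos q (q + 1 - k)
  have hk2 : (2 : ℚ) ≤ k := by exact_mod_cast hk
  have hq1 : (1 : ℚ) ≤ q := by
    have : 1 ≤ q := by omega
    exact_mod_cast this
  have hD : (0 : ℚ) < (q : ℚ) + k - 1 := by linarith
  have hDne : (q : ℚ) + k - 1 ≠ 0 := hD.ne'
  have hE : (0 : ℚ) < 2 * (q : ℚ) + k := by linarith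
  -- the anchor: (2q+k)·W_1(q+k−1, q) ≤ q+k−1
  have hW1le : (2 * (q : ℚ) + k) * sumW (q + k - 1) q 1 ≤ (q : ℚ) + k - 1 := by
    have hk2' : (0 : ℚ) ≤ (k : ℚ) - 2 := by linarith
    have := mul_nonneg hk2' hS1.le
    nlinarith [hanc]
  -- the last q-step, cleared: (q+k−1)·S(q+k,q) = (q+k)·(S(q+k−1,q) − W_1)
  have hstep : ((q : ℚ) + k - 1) * sumS (q + k) q
      = ((q : ℚ) + k) * (sumS (q + k - 1) q - sumW (q + k - 1) q 1) := by
    rw [hsh]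
    field_simp
  -- assemble: (q+k−1)(2q+k)(1 + S(q+k,q) − S(q,q+1−k)) ≥ (q+k−1)·q
  have hmain : ((q : ℚ) + k - 1) * q
      ≤ ((q : ℚ) + k - 1) * ((2 * (q : ℚ) + k) * (1 + sumS (q + k) q - sumS q (q + 1 - k))) := by
    have e1 : ((q : ℚ) + k - 1) * ((2 * (q : ℚ) + k) * (1 + sumS (q + k) q - sumS q (q + 1 - k)))
        = ((q : ℚ) + k - 1) * (2 * (q : ℚ) + k)
          + (2 * (q : ℚ) + k) * (((q : ℚ) + k) * (sumS (q + k - 1) q - sumW (q + k - 1) q 1))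
          - ((q : ℚ) + k - 1) * (2 * (q : ℚ) + k) * sumS q (q + 1 - k) := by
      rw [← hstep]; ring
    rw [e1]
    have p1 := mul_le_mul_of_nonneg_left hchain
      (show (0 : ℚ) ≤ (2 * (q : ℚ) + k) * ((q : ℚ) + k) by positivity)
    have p2 := mul_le_mul_of_nonneg_left hW1le (show (0 : ℚ) ≤ (q : ℚ) + k by positivity)
    have p3 : (0 : ℚ) ≤ (2 * (q : ℚ) + k) * sumS q (q + 1 - k) := by positivity
    nlinarith [p1, p2, p3]
  have hEX : (q : ℚ) ≤ (2 * (q : ℚ) + k) * (1 + sumS (q + k) q - sumS q (q + 1 - k)) :=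
    le_of_mul_le_mul_left hmain hD
  have hfin : (q : ℚ) / (2 * q + k) ≤ 1 + sumS (q + k) q - sumS q (q + 1 - k) := by
    rw [div_le_iff₀ hE]
    linarith [hEX]
  linarith

end PercRepro
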